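import Literature.NumberTheory.PAdicHodge.TatePairingPointOfKTwoTransport
import HarnessLib

/-!
# The transport matching along an equivariant HOMOMORPHISM of geometric points inducing an isomorphism of Tate modules (isogenies of degree
# prime to `p` composed with changes of variables) — `→+` twins of `TatePairingPointOfKTwoTransport` §0–§2

Topic `Literature/NumberTheory/PAdicHodge`; THEOREMS ONLY (no definition, no named fact, no instance, no `sorry`). In `TatePairingPointOfKTwoTransport` the
map `φ : (W ×_{K₀} F)(F̄) → E(F̄)` onto the good `𝒪_F`-model is an ISOMORPHISM of groups (`≃+`); its proofs use only that `φ` is an equivariant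
HOMOMORPHISM whose Tate-module map `T_p(φ)` (given as data `Tφ` with components `φ`, `hTφ`) is an isomorphism. This file records the same statements for
`φ : … →+ …` — the shape of an ISOGENY `W′ → W` of degree prime to `p` (tree `EllipticCurves.Isogeny`: an equivariant `→+` on geometric points with
finite kernel) composed with a change of variables onto the model, i.e. the Dokchitser–Dokchitser-free road to Kato's formula for every minimal
`W′ ∼ W` of a K★ cell (memo `Summits/…/Cruxes/StarredOptimalManinUnitFiveSeven/Lines/kato-lever-seam-rec-at-cells.md` §5, row ISOGENY).

* (private §0 twins `map_divSeq_hom`, `map_divSeq_fix_hom` — the gate's dedup sees their `≃+` originals; consumers restate the one-line facts inline,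
  likewise the equivariance of `em`, cf. `em_transport_smul`);
* ★ `em_transportHom_tadicKummer_eq_kummerCocycleO` — `em = θ_∞ ≫ T_p(φ) ≫ e` carries the `T`-adic Kummer cocycle of `P ∈ W(F)` to K1's `κ_u` with
  `uₙ = z(φ Qₙ)`.

Crux K★ `stmt-BirchSwinnertonDyer-22226` (route `EdixhovenFibreFiveSeven`, line `kato_lever`); BSD / K★ are NOT proved by this file.

## References
* J. H. Silverman, *AEC* (2009), III §4 (isogenies), III §7, Prop. VII.2.2, VIII §2. [SilvermanAEC2009]
* S. Bloch, K. Kato (1990), Ex. 3.10.1, (3.11.1). [BlochKato1990]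
-/

noncomputable section

open Field Function ValuativeRel WittVector NumberField IsDedekindDomain
open scoped NumberField Topology

namespace Literature.NumberTheory.PAdicHodge

open Literature.NumberTheory.GaloisRepresentations
open Literature.NumberTheory.GaloisRepresentations.IsNonarchimedeanLocalField
open Literature.NumberTheory.GaloisRepresentations.LubinTate
open Literature.NumberTheory.GaloisCohomology
open Literature.NumberTheory.EllipticCurves
open Literature.NumberTheory.EllipticCurves.FormalGroupChart
open Literature.NumberTheory.PAdicHodge.GaloisContinuity
open Literature.IUT.LogVolume
open _root_.WeierstrassCurve

namespace TransportHom

section Helpers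

variable {K₀ : Type} [Field K₀] (W : WeierstrassCurve K₀) {L : Type} [Field L] [Algebra K₀ L] {E' : WeierstrassCurve L}
  (φ : geomPoints (W.baseChange L) →+ E'.geomPoints)
  (hφ : ∀ (σ : absoluteGaloisGroup L) (P : geomPoints (W.baseChange L)), φ (σ • P) = σ • φ P)
  {p : ℕ} [Fact p.Prime]
  (Tφ : (W.baseChange L).tateModule p ≃ₗ[ℤ_[p]] E'.tateModule p)
  (hTφ : ∀ (a : (W.baseChange L).tateModule p) (n : ℕ), TateModule.proj p n (Tφ a) = φ (TateModule.proj p n a))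

omit [Fact p.Prime] in
/-- A division sequence of `W(L̄)` maps to a division sequence of `E'(L̄)`. [cite: SilvermanAEC2009, VIII §2] -/
private theorem map_divSeq_hom {Q : ℕ → geomPoints (W.baseChange L)} (hQ : ∀ n, p • Q (n + 1) = Q n) (n : ℕ) :
    p • (⇑φ ∘ Q) (n + 1) = (⇑φ ∘ Q) n := by
  change p • φ (Q (n + 1)) = φ (Q n)
  rw [← map_nsmul, hQ]

omit [Fact p.Prime] in
include hφ in
/-- The image of a `Γ_L`-fixed base is `Γ_L`-fixed. [cite: SilvermanAEC2009, VIII §1] -/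
private theorem map_divSeq_fix_hom {Q : ℕ → geomPoints (W.baseChange L)} (hfix : ∀ σ : absoluteGaloisGroup L, σ • Q 0 = Q 0)
    (σ : absoluteGaloisGroup L) : σ • (⇑φ ∘ Q) 0 = (⇑φ ∘ Q) 0 := by
  change σ • φ (Q 0) = φ (Q 0)
  rw [← hφ, hfix]

end Helpers

section Completion

variable {K : Type} [Field K] [NumberField K] {p : ℕ} [hprime : Fact p.Prime] (v : HeightOneSpectrum (𝓞 K))
  [CharZero (v.adicCompletion K)] [LocallyCompactSpace (absoluteGaloisGroup (v.adicCompletion K))]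
  [Fact (¬ IsUnit (p : integerC (v.adicCompletion K)))]
  [IsAdicComplete (Ideal.span {(p : integerC (v.adicCompletion K))}) (integerC (v.adicCompletion K))]
  [CharP 𝓀[v.adicCompletion K] p]
  {K₀ : Type} [Field K₀] [CharZero K₀] (W : WeierstrassCurve K₀) [W.IsElliptic] [Algebra K₀ (v.adicCompletion K)]
  (hpv : valuation (v.adicCompletion K) (p : v.adicCompletion K) < 1)
  (Dv : EisensteinRoot (v.adicCompletion K) p hpv) (Wm : WeierstrassCurve (EisensteinRoot.CoeffDisc Dv))
  (ψm : EisensteinRoot.CoeffDisc Dv →+* LTCoeff (v.adicCompletion K))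
  (hψm : ∀ c, algebraMap (LTCoeff (v.adicCompletion K)) (v.adicCompletion K) (ψm c) = EisensteinRoot.CoeffDisc.toF Dv c)
  (hp2 : p ≠ 2) (hΔ : IsUnit (Wm.map ψm).Δ) (hA : ((Wm.map ψm).map (AinfTop.redCoeff (v.adicCompletion K))).hasseCoeff p = 0)
  [(curveOver (CompletedAlgClosure (v.adicCompletion K)) (Wm.map ψm)).IsElliptic]
  -- the isomorphism of geometric points onto the good model, and its Tate-module map
  (φ : geomPoints (W.baseChange (v.adicCompletion K)) →+ (AinfTop.curveFO (v.adicCompletion K) (Wm.map ψm)).geomPoints)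
  (hφ : ∀ (σ : absoluteGaloisGroup (v.adicCompletion K)) (P : geomPoints (W.baseChange (v.adicCompletion K))), φ (σ • P) = σ • φ P)
  (Tφ : (W.baseChange (v.adicCompletion K)).tateModule p ≃ₗ[ℤ_[p]] (AinfTop.curveFO (v.adicCompletion K) (Wm.map ψm)).tateModule p)
  (hTφ : ∀ (a : (W.baseChange (v.adicCompletion K)).tateModule p) (n : ℕ), TateModule.proj p n (Tφ a) = φ (TateModule.proj p n a))
  -- the Weil tower of `W`
  (e : (k : ℕ) → geomTorsion W ((p ^ k : ℕ) : ℤ) → geomTorsion W ((p ^ k : ℕ) : ℤ) → AlgebraicClosure K₀)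
  (hμ : ∀ k S T, e k S T ^ (p ^ k) = 1) (hadd₁ : ∀ k S₁ S₂ T, e k (S₁ + S₂) T = e k S₁ T * e k S₂ T)
  (hadd₂ : ∀ k S T₁ T₂, e k S (T₁ + T₂) = e k S T₁ * e k S T₂)
  (hgal : ∀ k (σ : absoluteGaloisGroup K₀) (S T : geomTorsion W ((p ^ k : ℕ) : ℤ)), σ • e k S T = e k (σ • S) (σ • T))
  (hcompat : ∀ k (S T : geomTorsion W ((p ^ (k + 1) : ℕ) : ℤ)),
    e k (torsionMulHom W (p ^ (k + 1)) (p ^ k) p (pow_succ p k).symm S)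
      (torsionMulHom W (p ^ (k + 1)) (p ^ k) p (pow_succ p k).symm T) = e (k + 1) S T ^ p)

/-! ### §2 `em` carries the `T`-adic Kummer cocycle of `W` to K1's `κ_u`; the K1 pair integrates it -/

omit [LocallyCompactSpace (absoluteGaloisGroup (HeightOneSpectrum.adicCompletion K v))] [Fact (¬ IsUnit (p : integerC (v.adicCompletion K)))]
  [IsAdicComplete (Ideal.span {(p : integerC (v.adicCompletion K))}) (integerC (v.adicCompletion K))] in
include hφ hTφ in
/-- **`em` carries the `T`-adic Kummer cocycle `κ_Q` of `W` to K1's `κ_u`** with `uₙ = z(φ Qₙ)`. [cite: SilvermanAEC2009, Prop. VII.2.2 and VIII §2] -/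
theorem em_transportHom_tadicKummer_eq_kummerCocycleO
    {Q : ℕ → geomPoints (W.baseChange (v.adicCompletion K))} (hQ : ∀ n, p • Q (n + 1) = Q n)
    (hfix : ∀ σ : absoluteGaloisGroup (v.adicCompletion K), σ • Q 0 = Q 0)
    (hker : ∀ n, AinfTop.geomToCO (Wm.map ψm) ((⇑φ ∘ Q) n) ∈ kernel (NormedField.valuation (K := CompletedAlgClosure (v.adicCompletion K))) (curveOver (CompletedAlgClosure (v.adicCompletion K)) (Wm.map ψm)))
    (κ : contOneCocycles (restrictedTateRep W (v.adicCompletion K) p).toTopRep)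
    (hκ : ∀ σ, κ.1 σ = (tateModuleEquiv W (v.adicCompletion K) p).symm
      (TateModule.mk (fun n => σ • Q n - Q n) (pow_smul_gal_sub_divSeq_eq_zero W (v.adicCompletion K) p hQ hfix σ)
        (smul_gal_sub_divSeq_succ W (v.adicCompletion K) p hQ σ)))
    (τ : absoluteGaloisGroup (v.adicCompletion K)) :
    ((tateModuleEquiv W (v.adicCompletion K) p).trans (Tφ.trans (AinfTop.tateGeomEquivTatePtOSS (v.adicCompletion K) (Wm.map ψm) p hp2 hΔ hA))) (κ.1 τ) =
      AinfRamTop.kummerCocycleO Wm ψm hψm (fun n => zPt (AinfTop.geomToCO (Wm.map ψm) ((⇑φ ∘ Q) n)) (hker n))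
        (AinfTop.mulPC_zPt_divSeqO Wm ψm hψm (Q := ⇑φ ∘ Q) (map_divSeq_hom W φ hQ) hker)
        (AinfTop.galCBall_zPt_divSeqO_zero Wm ψm (Q := ⇑φ ∘ Q) (map_divSeq_fix_hom W φ hφ hfix) hker) τ := by
  rw [hκ, LinearEquiv.trans_apply, LinearEquiv.apply_symm_apply, LinearEquiv.trans_apply]
  have hT : Tφ (TateModule.mk (fun n => τ • Q n - Q n) (pow_smul_gal_sub_divSeq_eq_zero W (v.adicCompletion K) p hQ hfix τ)
        (smul_gal_sub_divSeq_succ W (v.adicCompletion K) p hQ τ)) =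
      TateModule.mk (fun n => τ • (⇑φ ∘ Q) n - (⇑φ ∘ Q) n)
        (AinfTop.pow_smul_kummerO_eq_zero Wm ψm (Q := ⇑φ ∘ Q) (map_divSeq_hom W φ hQ) (map_divSeq_fix_hom W φ hφ hfix) τ)
        (AinfTop.smul_kummerO_succ Wm ψm (Q := ⇑φ ∘ Q) (map_divSeq_hom W φ hQ) τ) :=
    TateModule.ext fun n => by
      rw [hTφ, TateModule.proj_mk, TateModule.proj_mk, map_sub, hφ]
      rfl
  rw [hT]
  exact AinfTop.tateGeomEquivTatePtOSS_kummer Wm ψm hψm hp2 hΔ hA (Q := ⇑φ ∘ Q) (map_divSeq_hom W φ hQ) (map_divSeq_fix_hom W φ hφ hfix) hker τ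

end Completion

end TransportHom

end Literature.NumberTheory.PAdicHodge

end
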